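import Summits.QuantumFields.YangMills.Theorems.UnitScaleTiltProp7CminOfP6T3Pd
import Summits.QuantumFields.YangMills.Theorems.UnitScaleTiltProp7SPrintDefsS
import HarnessLib

/-!
# Route `UnitScaleTilt`, crux K1 child «MinimiserStabilityRegPr» (stmt-QuantumFields-19200), skeleton v10, stub `stub_existenceMinimalOrbit` (EX), route (α) — **C-minˢ ⇐ P6@T³
# (PROVED) ∧ CHART-112ˢ (displayed) ∧ GROWTH (✓`growth142_T3`, its (γ)-input displayed in the `ˢ` letters): THE (α-S) COPY OF ✓`Prop7CminOfP6T3Pd.Cmin_of_P6T3_chart_growth_pd`**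
# (★★OWNER RULING g26-№19 «(α-S) ADOPTED … (i) `hChart`'s (20) conjunct → `AvgCondPrintS` with the explicit witness, (ii) `hGrowth`'s antecedents re-lettered to `NormS`, (iii)
# `…CminOfP6T3Pd…S` mechanical copy»; knit ruler's letter plan (J1), bus 2026-08-28 ≈08:55Z: the MINIMISER's (20) is the re-based `AvgCondPrintS`, the COMPETITOR binder keeps
# print's comb `AvgCondPrint` — which is exactly what ✓`growth142_T3` concludes and what COV supplies)

Cell `ym3-torus`, width seat `ym-ust-19200-w2` (gen 3; EX KNIT RULER, RULING g26-№19 ORDER (2) file F2).  THEOREMS ONLY (0 `def`, 0 `sorry`).  By-name bookkeeping around the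
PROVED Prop. 6 kernel: nothing here closes the stub; `--supports stmt-QuantumFields-19200 --as helper`, count-neutral.  YM₃ on T³ is a ladder rung (R3), not the Clay problem;
nothing here claims the stub, the crux, d = 4 or the mass gap.

THE PRINT ([Balaban1985Variational] p. 296 and p. 299, verbatim): *«Equation (111) has a solution belonging to the space (115) with ε₄ = 2B₀C₁B₃ε₁, if 2B₀C₁B₃ε₁ ≤ a₄. This
solution determines a critical configuration U₁ by the transformation (112)»*; *«… the configuration A′₁ − HD(A′₁) = 1/iη log U₁ satisfying all the conditions (19)–(21) … It is a
critical configuration of the functional (5) … Hence A′ = 0 is a minimum»*.  THE RE-BASE (RULING g26-№19): print's (20) «U′ = (U₁U₀)^u axial (1.19), u restricted (1.29), Ũ′ʲ = VŪ₀ʲ⁻¹»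
([Balaban1985RegularSpaces] (1.28)–(1.30) p. 81) is replaced, FOR THE CHART'S OWN POINT `X`, by `Prop7SPrint.AvgCondPrintS` — the witness `u` normalised by (1.19) and the symmetric
top-centre clause `u↓(y) = (w^{sym}_{iX}(y))⁻¹` (`NormS`), the S twin of [Balaban1985Averaging] (87) p. 31 — because the chart of record is the symmetric-frame chart `logChartTwS`;
the competitors `X′` of the growth clause keep print's comb slice (they come from [Balaban1985RegularSpaces] Thm 2 through COV).

WHAT IS PROVED.  ★★ **`Cmin_of_P6T3_chart_growth_pd_S`** — the statement and proof of ✓`Cmin_of_P6T3_chart_growth_pd` TOKEN FOR TOKEN except for three letters: in `hChart` the (20)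
conjunct reads `AvgCondPrintS V U₀ X` and the E–L clause quantifies over `NormS U₀ X (e^{iX}) u` (instead of `RestrictedPrint u`); in `hGrowth` the antecedents read
`AvgCondPrintS V U₀ X`, `NormS U₀ X (e^{iX}) u`, `W = (e^{iX}U₀)^u` (the separate `IsAxialPrint W` antecedent is clause (i) of `NormS` and is dropped); in the conclusion the
minimiser carries `AvgCondPrintS V U₀ X`, the competitor binder `AvgCondPrint V U₀ X′` VERBATIM (= the conclusion of ✓`growth142_T3`, which reads the minimiser's (20) only through
«`W ∈ 𝔅_k(V)`»).  Constants unchanged: `B₀′ = max{B₀, 5MB₀/2, ½}`, `a₄′ = min{¼, a₃/4, (16B₀C₄)⁻¹, α, 2r/3, (½ − θ)/(C_P(17088 + c_S))}`.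

HONEST SCOPE.  Bookkeeping: the analytic content is in the displayed rows (N06(d = 3) ×2, Prop. 4, (1.37), CHART-112ˢ, (γ)-growth) and in the PROVED Prop. 6 kernel
(✓`Prop7SectET3ObjectsPd.prop6_T3`); count-neutral helper toward stmt-QuantumFields-19200, not a proof of the stub.

References: T. Bałaban, CMP 102 (1985) 277–309 [Balaban1985Variational] ((14) p.280, (19)–(21) p.281, (47) p.285, (103) p.293, (111)–(112) p.294, Props 5–6 pp.294–296,
(115)–(117) p.295, (123)–(142) pp.296–299, Prop. 7 p.299); CMP 99 (1985) 389–434 [Balaban1985BackgroundPropagators] (Thms 3.12–3.13); CMP 99 (1985) 75–102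
[Balaban1985RegularSpaces] ((1.19) p.79, (1.28)–(1.30) p.81, (1.37) p.82, Thm 2 p.83); CMP 98 (1985) 17–51 [Balaban1985Averaging] ((87) p.31).
-/

set_option autoImplicit false

noncomputable section

open scoped BigOperators Matrix.Norms.L2Operator Matrix

namespace Summit.QuantumFields.YangMills.Theorems.Prop7CminOfP6T3PdS

open Literature.MathematicalPhysics.QuantumFieldTheory.Balaban1983to89
open Literature.MathematicalPhysics.QuantumFieldTheory.Balaban1983to89.T3ContinuumYM3Torus
open Literature.MathematicalPhysics.QuantumFieldTheory.Balaban1983to89.T3UnitLawDensityEML (ℰp)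
open Literature.MathematicalPhysics.QuantumFieldTheory.Balaban1983to89.T3ConstrainedMinimiser (fibre)
open Literature.MathematicalPhysics.QuantumFieldTheory.Balaban1983to89.T3PrintedRegularMinimiser (RegPr regFibrePr)
open Literature.MathematicalPhysics.QuantumFieldTheory.Balaban1983to89.T3PrintedRegularOrbits (descTransf)
open Literature.MathematicalPhysics.QuantumFieldTheory.Balaban1983to89.T3Thm1Carrier
open Literature.MathematicalPhysics.QuantumFieldTheory.Balaban1983to89.T3SectALandauChart (In19 emb15 CloseAvg)
open BlockAveragingEMLLinearisedBackground (pertVar)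
open B9SectCLatticeCarrier (Bond)
open B11Eq115Space (NegSize Space115)
open B11Eq111FrakG (nabla115)
open B11Eq98CurrentSlot (Jcur)
open B13Contraction113 (QuadAnalytic)
open Summit.QuantumFields.YangMills.Theorems.Prop7TPrint (nMax19 expHermField expHermField_apply coe_expHerm)
open Summit.QuantumFields.YangMills.Theorems.Prop7SPrint (AvgCondPrint AvgCondPrintS NormS IsLandauPrint RestrictedPrint IsAxialPrint)
open B4Sect5Torus (TSite)
open B10Eq27TorusAxialLog (unitsField toUField)
open Summit.QuantumFields.YangMills.Theorems.Prop7SectET3ObjectsPd (prop6_T3)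
open Summit.QuantumFields.YangMills.Theorems.Prop7Growth142T3 (growth142_T3)

variable {L : ℕ}

/-- ★★ **C-minˢ FROM PROPOSITION 6 AT THE T³ OBJECTS (PROVED), CHART-112ˢ (DISPLAYED) AND ✓`growth142_T3` (its (γ)-input DISPLAYED in the `ˢ` letters), LATTICE ABSTRACT** — the
(α-S) copy of ✓`Cmin_of_P6T3_chart_growth_pd`: same letters `𝒢f`, `Wf`, `H₁f`, `Bf`, same rows `norm_G`, `prop4`, `norm_H₁`, `bound20`; `hChart` = CHART-112ˢ (a small solution of
(111) charts to `X` Hermitian-traceless with `nMax19 ≤ M(‖A₁‖ + ‖H₁B‖)`, the RE-BASED (20) `AvgCondPrintS`, (21), E–L-critical at its `NormS`-representatives); `hGrowth` = the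
(γ)-input of ✓`growth142_T3` with the antecedents `AvgCondPrintS X`, `NormS U₀ X (e^{iX}) u`, `W = (e^{iX}U₀)^u ∈ 𝔅_k(V)`, E–L.  Conclusion: the body of C-minˢ
(✓`Prop7ExistRouteAlphaMinS.existenceMinimalOrbit_of_CminS_cov`'s `hC`) at `(L, B₃)` VERBATIM — minimiser `AvgCondPrintS`, competitors print's `AvgCondPrint`.
[cite: Balaban1985Variational, Prop. 6 p.295, (112) p.294, p.296, (141)-(142) p.299, (19)-(21) p.281, (14) p.280, (103) p.293; Balaban1985RegularSpaces, (1.28)-(1.30) p.81; Balaban1985Averaging, (87) p.31] -/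
theorem Cmin_of_P6T3_chart_growth_pd_S (hL : 1 < L) {B₃ : ℝ} (hB₃ : 3 * (L : ℝ) ≤ B₃)
    [hFL : ∀ F : T3Family, Fact (0 < (F.L : ℝ))] [hFη : ∀ (F : T3Family) (k : ℕ), Fact (0 < ((F.L : ℝ)⁻¹) ^ k)]
    -- the lattice periods and the site charts, ABSTRACT (periodsT3 ∕ towerP are instances)
    (Pd : ∀ i : Idx L, Fin (i.1.1.P i.1.2.2).d → ℕ) (e : ∀ i : Idx L, Site (i.1.1.P i.1.2.2) 0 ≃ TSite (i.1.1.P i.1.2.2).d (Pd i))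
    (he : ∀ (i : Idx L) (x : Site (i.1.1.P i.1.2.2) 0) (μ : Fin (i.1.1.P i.1.2.2).d), e i (x.shift μ) = B9Eq33CovDerivVector.shiftEquiv μ (e i x))
    {B₀ C₄ a₃ α r M CP θ cS : ℝ} (hB₀ : 0 < B₀) (hC₄ : 0 < C₄) (ha₃ : 0 < a₃) (hα : 0 < α) (hr : 0 < r) (hM : 0 < M) (hCP : 0 < CP) (hθ : θ < 1 / 2)
    (hcS : 0 ≤ cS)
    -- the curved letters, OPAQUE
    (𝒢f : ∀ (i : Idx L) (U₀ : GaugeField (i.1.1.P i.1.2.2) 0 (Matrix.specialUnitaryGroup (Fin 2) ℂ)),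
      NegSize (i.1.1.L : ℝ) (((i.1.1.L : ℝ)⁻¹) ^ (i.1.2.2 - i.1.2.1)) (fun _ : Bond (i.1.1.P i.1.2.2).d (Pd i) => i.1.2.2 - i.1.2.1) 3
          (Matrix (Fin 2) (Fin 2) ℂ) →L[ℂ]
        Space115 (i.1.1.L : ℝ) (((i.1.1.L : ℝ)⁻¹) ^ (i.1.2.2 - i.1.2.1)) (fun _ : Bond (i.1.1.P i.1.2.2).d (Pd i) => i.1.2.2 - i.1.2.1)
          (fun _ : Bond (i.1.1.P i.1.2.2).d (Pd i) × Fin (i.1.1.P i.1.2.2).d => i.1.2.2 - i.1.2.1) (nabla115 (((i.1.1.L : ℝ)⁻¹) ^ (i.1.2.2 - i.1.2.1)) (fun b : Bond (i.1.1.P i.1.2.2).d (Pd i) => unitsField (toUField U₀) ⟨(e i).symm b.1, b.2⟩)))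
    (Wf : ∀ (i : Idx L) (U₀ : GaugeField (i.1.1.P i.1.2.2) 0 (Matrix.specialUnitaryGroup (Fin 2) ℂ)),
      Space115 (i.1.1.L : ℝ) (((i.1.1.L : ℝ)⁻¹) ^ (i.1.2.2 - i.1.2.1)) (fun _ : Bond (i.1.1.P i.1.2.2).d (Pd i) => i.1.2.2 - i.1.2.1)
          (fun _ : Bond (i.1.1.P i.1.2.2).d (Pd i) × Fin (i.1.1.P i.1.2.2).d => i.1.2.2 - i.1.2.1) (nabla115 (((i.1.1.L : ℝ)⁻¹) ^ (i.1.2.2 - i.1.2.1)) (fun b : Bond (i.1.1.P i.1.2.2).d (Pd i) => unitsField (toUField U₀) ⟨(e i).symm b.1, b.2⟩)) →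
        NegSize (i.1.1.L : ℝ) (((i.1.1.L : ℝ)⁻¹) ^ (i.1.2.2 - i.1.2.1)) (fun _ : Bond (i.1.1.P i.1.2.2).d (Pd i) => i.1.2.2 - i.1.2.1) 3 (Matrix (Fin 2) (Fin 2) ℂ))
    (β : Idx L → Type) [∀ i, Fintype (β i)]
    (H₁f : ∀ (i : Idx L) (U₀ : GaugeField (i.1.1.P i.1.2.2) 0 (Matrix.specialUnitaryGroup (Fin 2) ℂ)),
      (β i → Matrix (Fin 2) (Fin 2) ℂ) →L[ℂ]
        Space115 (i.1.1.L : ℝ) (((i.1.1.L : ℝ)⁻¹) ^ (i.1.2.2 - i.1.2.1)) (fun _ : Bond (i.1.1.P i.1.2.2).d (Pd i) => i.1.2.2 - i.1.2.1)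
          (fun _ : Bond (i.1.1.P i.1.2.2).d (Pd i) × Fin (i.1.1.P i.1.2.2).d => i.1.2.2 - i.1.2.1) (nabla115 (((i.1.1.L : ℝ)⁻¹) ^ (i.1.2.2 - i.1.2.1)) (fun b : Bond (i.1.1.P i.1.2.2).d (Pd i) => unitsField (toUField U₀) ⟨(e i).symm b.1, b.2⟩)))
    (Bf : ∀ (i : Idx L), GaugeField (i.1.1.P i.1.2.1) 0 (Matrix.specialUnitaryGroup (Fin 2) ℂ) → GaugeField (i.1.1.P i.1.2.2) 0 (Matrix.specialUnitaryGroup (Fin 2) ℂ) →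
      β i → Matrix (Fin 2) (Fin 2) ℂ)
    -- their displayed bounds (the `SectEDatum` fields at admissible backgrounds)
    (norm_G : ∀ (i : Idx L) (e : ℝ) (U₀ : GaugeField (i.1.1.P i.1.2.2) 0 (Matrix.specialUnitaryGroup (Fin 2) ℂ)),
      RegPr i.1.1 i.1.2.1 i.1.2.2 e U₀ → e ≤ α → ∀ f, ‖𝒢f i U₀ f‖ ≤ B₀ * ‖f‖)
    (prop4 : ∀ (i : Idx L) (e : ℝ) (U₀ : GaugeField (i.1.1.P i.1.2.2) 0 (Matrix.specialUnitaryGroup (Fin 2) ℂ)),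
      RegPr i.1.1 i.1.2.1 i.1.2.2 e U₀ → e ≤ α → QuadAnalytic (Wf i U₀) C₄ a₃)
    (norm_H₁ : ∀ (i : Idx L) (e : ℝ) (U₀ : GaugeField (i.1.1.P i.1.2.2) 0 (Matrix.specialUnitaryGroup (Fin 2) ℂ)),
      RegPr i.1.1 i.1.2.1 i.1.2.2 e U₀ → e ≤ α → ∀ b, ‖H₁f i U₀ b‖ ≤ B₀ * ‖b‖)
    (bound20 : ∀ (i : Idx L) (ε₁ : ℝ) (V : GaugeField (i.1.1.P i.1.2.1) 0 (Matrix.specialUnitaryGroup (Fin 2) ℂ))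
      (U₀ : GaugeField (i.1.1.P i.1.2.2) 0 (Matrix.specialUnitaryGroup (Fin 2) ℂ)), 0 < ε₁ → PlaqSmall ε₁ V →
      RegPr i.1.1 i.1.2.1 i.1.2.2 ((L : ℝ) ^ 3 * B₃ * ε₁) U₀ → CloseAvg i.1.1 i.1.2.1 i.1.2.2 i.2.2.le ((L : ℝ) ^ 3 * ε₁) V U₀ →
      ‖Bf i V U₀‖ < 2 * ((3 : ℝ) * i.1.1.L) * ((L : ℝ) ^ 3 * ε₁))
    -- (i) CHART-112, displayed
    (hChart : ∀ (i : Idx L) (ε₁ : ℝ) (V : GaugeField (i.1.1.P i.1.2.1) 0 (Matrix.specialUnitaryGroup (Fin 2) ℂ))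
      (U₀ : GaugeField (i.1.1.P i.1.2.2) 0 (Matrix.specialUnitaryGroup (Fin 2) ℂ)), 0 < ε₁ → PlaqSmall ε₁ V →
      RegPr i.1.1 i.1.2.1 i.1.2.2 ((L : ℝ) ^ 3 * B₃ * ε₁) U₀ → CloseAvg i.1.1 i.1.2.1 i.1.2.2 i.2.2.le ((L : ℝ) ^ 3 * ε₁) V U₀ → (L : ℝ) ^ 3 * B₃ * ε₁ ≤ α →
      ∀ A₁ : Space115 (i.1.1.L : ℝ) (((i.1.1.L : ℝ)⁻¹) ^ (i.1.2.2 - i.1.2.1)) (fun _ : Bond (i.1.1.P i.1.2.2).d (Pd i) => i.1.2.2 - i.1.2.1)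
          (fun _ : Bond (i.1.1.P i.1.2.2).d (Pd i) × Fin (i.1.1.P i.1.2.2).d => i.1.2.2 - i.1.2.1) (nabla115 (((i.1.1.L : ℝ)⁻¹) ^ (i.1.2.2 - i.1.2.1)) (fun b : Bond (i.1.1.P i.1.2.2).d (Pd i) => unitsField (toUField U₀) ⟨(e i).symm b.1, b.2⟩)),
        ‖A₁‖ < r → A₁ + 𝒢f i U₀ (Jcur (fun b : Bond (i.1.1.P i.1.2.2).d (Pd i) => unitsField (toUField U₀) ⟨(e i).symm b.1, b.2⟩)) + 𝒢f i U₀ (Wf i U₀ (A₁ + H₁f i U₀ (Bf i V U₀))) = 0 →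
        ∃ X : PBond (i.1.1.P i.1.2.2) 0 → Matrix (Fin 2) (Fin 2) ℂ,
          (∀ b : PBond (i.1.1.P i.1.2.2) 0, (X b).IsHermitian ∧ Matrix.trace (X b) = 0) ∧
          nMax19 i.1.1 i.1.2.1 i.1.2.2 U₀ X ≤ M * (‖A₁‖ + ‖H₁f i U₀ (Bf i V U₀)‖) ∧
          AvgCondPrintS i.1.1 i.1.2.1 i.1.2.2 i.2.2.le V U₀ X ∧ IsLandauPrint i.1.1 i.1.2.1 i.1.2.2 U₀ X ∧
          (∀ u : GaugeTransf (i.1.1.P i.1.2.2) 0 (Matrix.specialUnitaryGroup (Fin 2) ℂ), NormS i.1.1 i.1.2.1 i.1.2.2 i.2.2.le U₀ X (expHermField X) u →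
            GaugeField.gaugeAct u (emb15 U₀ (expHermField X)) ∈ fibre i.1.1 ℰp i.1.2.1 i.1.2.2 i.2.2.le V →
            ∀ γ : ℝ → GaugeField (i.1.1.P i.1.2.2) 0 (Matrix.specialUnitaryGroup (Fin 2) ℂ), γ 0 = GaugeField.gaugeAct u (emb15 U₀ (expHermField X)) →
              (∀ t, γ t ∈ fibre i.1.1 ℰp i.1.2.1 i.1.2.2 i.2.2.le V) →
              (∀ b, DifferentiableAt ℝ (fun t => ((γ t b : Matrix.specialUnitaryGroup (Fin 2) ℂ) : Matrix (Fin 2) (Fin 2) ℂ)) 0) →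
                deriv (fun t => wilsonAction4 (γ t)) 0 = 0))
    -- (ii) the (γ)-input of ★w4's `growth142_T3`, displayed member-uniformly
    (hGrowth : ∀ (i : Idx L) (ε₁ ε₄ : ℝ) (V : GaugeField (i.1.1.P i.1.2.1) 0 (Matrix.specialUnitaryGroup (Fin 2) ℂ))
      (U₀ : GaugeField (i.1.1.P i.1.2.2) 0 (Matrix.specialUnitaryGroup (Fin 2) ℂ)) (X : PBond (i.1.1.P i.1.2.2) 0 → Matrix (Fin 2) (Fin 2) ℂ)
      (u : GaugeTransf (i.1.1.P i.1.2.2) 0 (Matrix.specialUnitaryGroup (Fin 2) ℂ)) (W : GaugeField (i.1.1.P i.1.2.2) 0 (Matrix.specialUnitaryGroup (Fin 2) ℂ)),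
      0 < ε₁ → ε₄ ≤ 1 / 4 → (L : ℝ) ^ 3 * B₃ * ε₁ ≤ ε₄ → PlaqSmall ε₁ V → RegPr i.1.1 i.1.2.1 i.1.2.2 ((L : ℝ) ^ 3 * B₃ * ε₁) U₀ →
      CloseAvg i.1.1 i.1.2.1 i.1.2.2 i.2.2.le ((L : ℝ) ^ 3 * ε₁) V U₀ → (∀ b : PBond (i.1.1.P i.1.2.2) 0, (X b).IsHermitian ∧ Matrix.trace (X b) = 0) →
      nMax19 i.1.1 i.1.2.1 i.1.2.2 U₀ X < ε₄ → AvgCondPrintS i.1.1 i.1.2.1 i.1.2.2 i.2.2.le V U₀ X → IsLandauPrint i.1.1 i.1.2.1 i.1.2.2 U₀ X →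
      NormS i.1.1 i.1.2.1 i.1.2.2 i.2.2.le U₀ X (expHermField X) u → W = GaugeField.gaugeAct u (emb15 U₀ (expHermField X)) →
      W ∈ fibre i.1.1 ℰp i.1.2.1 i.1.2.2 i.2.2.le V →
      (∀ γ : ℝ → GaugeField (i.1.1.P i.1.2.2) 0 (Matrix.specialUnitaryGroup (Fin 2) ℂ), γ 0 = W → (∀ t, γ t ∈ fibre i.1.1 ℰp i.1.2.1 i.1.2.2 i.2.2.le V) →
        (∀ b, DifferentiableAt ℝ (fun t => ((γ t b : Matrix.specialUnitaryGroup (Fin 2) ℂ) : Matrix (Fin 2) (Fin 2) ℂ)) 0) →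
          deriv (fun t => wilsonAction4 (γ t)) 0 = 0) →
      ∀ W' : GaugeField (i.1.1.P i.1.2.2) 0 (Matrix.specialUnitaryGroup (Fin 2) ℂ), W' ∈ regFibrePr i.1.1 i.1.2.1 i.1.2.2 i.2.2.le (178 * ε₄) V →
        ∃ g : GaugeTransf (i.1.1.P i.1.2.2) 0 (Matrix.specialUnitaryGroup (Fin 2) ℂ), descTransf i.1.1 i.1.2.1 i.1.2.2 i.2.2.le g = (fun _ => 1) ∧
          (∑ b : PBond (i.1.1.P i.1.2.2) 0, ‖pertVar W (GaugeField.gaugeAct g W') b‖ ^ 2 ≤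
            CP * ((i.1.1.L : ℝ) ^ (i.1.2.2 - i.1.2.1)) ^ 2 * ∑ p : Plaq (i.1.1.P i.1.2.2) 0,
              ‖((GaugeField.plaqHol (GaugeField.gaugeAct g W') p : Matrix.specialUnitaryGroup (Fin 2) ℂ) : Matrix (Fin 2) (Fin 2) ℂ)
                  * star ((GaugeField.plaqHol W p : Matrix.specialUnitaryGroup (Fin 2) ℂ) : Matrix (Fin 2) (Fin 2) ℂ) - 1‖ ^ 2) ∧
          (-(θ * ∑ p : Plaq (i.1.1.P i.1.2.2) 0,
              ‖((GaugeField.plaqHol (GaugeField.gaugeAct g W') p : Matrix.specialUnitaryGroup (Fin 2) ℂ) : Matrix (Fin 2) (Fin 2) ℂ)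
                  * star ((GaugeField.plaqHol W p : Matrix.specialUnitaryGroup (Fin 2) ℂ) : Matrix (Fin 2) (Fin 2) ℂ) - 1‖ ^ 2) -
              (cS * ε₄ * (((i.1.1.L : ℝ) ^ (i.1.2.2 - i.1.2.1)) ^ 2)⁻¹) * ∑ b : PBond (i.1.1.P i.1.2.2) 0, ‖pertVar W (GaugeField.gaugeAct g W') b‖ ^ 2 ≤
            ∑ p : Plaq (i.1.1.P i.1.2.2) 0, (1 / 2) * ((((((GaugeField.plaqHol W p : Matrix.specialUnitaryGroup (Fin 2) ℂ) : Matrix (Fin 2) (Fin 2) ℂ)) - 1)ᴴ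
              * (((((GaugeField.gaugeAct g W' ⟨p.src, p.μ⟩ : Matrix.specialUnitaryGroup (Fin 2) ℂ) : Matrix (Fin 2) (Fin 2) ℂ) * star (W ⟨p.src, p.μ⟩ : Matrix (Fin 2) (Fin 2) ℂ) - 1)
                  + (W ⟨p.src, p.μ⟩ : Matrix (Fin 2) (Fin 2) ℂ)
                      * (((GaugeField.gaugeAct g W' ⟨p.src.shift p.μ, p.ν⟩ : Matrix.specialUnitaryGroup (Fin 2) ℂ) : Matrix (Fin 2) (Fin 2) ℂ) *
                          star (W ⟨p.src.shift p.μ, p.ν⟩ : Matrix (Fin 2) (Fin 2) ℂ) - 1)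
                      * star (W ⟨p.src, p.μ⟩ : Matrix (Fin 2) (Fin 2) ℂ)
                  - ((W ⟨p.src, p.μ⟩ * W ⟨p.src.shift p.μ, p.ν⟩ * (W ⟨p.src.shift p.ν, p.μ⟩)⁻¹ : Matrix.specialUnitaryGroup (Fin 2) ℂ) :
                        Matrix (Fin 2) (Fin 2) ℂ)
                      * (((GaugeField.gaugeAct g W' ⟨p.src.shift p.ν, p.μ⟩ : Matrix.specialUnitaryGroup (Fin 2) ℂ) : Matrix (Fin 2) (Fin 2) ℂ) *
                          star (W ⟨p.src.shift p.ν, p.μ⟩ : Matrix (Fin 2) (Fin 2) ℂ) - 1)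
                      * star ((W ⟨p.src, p.μ⟩ * W ⟨p.src.shift p.μ, p.ν⟩ * (W ⟨p.src.shift p.ν, p.μ⟩)⁻¹ : Matrix.specialUnitaryGroup (Fin 2) ℂ) :
                        Matrix (Fin 2) (Fin 2) ℂ)
                  - ((GaugeField.plaqHol W p : Matrix.specialUnitaryGroup (Fin 2) ℂ) : Matrix (Fin 2) (Fin 2) ℂ)
                      * (((GaugeField.gaugeAct g W' ⟨p.src, p.ν⟩ : Matrix.specialUnitaryGroup (Fin 2) ℂ) : Matrix (Fin 2) (Fin 2) ℂ) * star (W ⟨p.src, p.ν⟩ : Matrix (Fin 2) (Fin 2) ℂ) - 1)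
                      * star ((GaugeField.plaqHol W p : Matrix.specialUnitaryGroup (Fin 2) ℂ) : Matrix (Fin 2) (Fin 2) ℂ))
                * ((GaugeField.plaqHol W p : Matrix.specialUnitaryGroup (Fin 2) ℂ) : Matrix (Fin 2) (Fin 2) ℂ))).trace).re)) :
    ∃ B₀' a₄' : ℝ, 0 < B₀' ∧ 0 < a₄' ∧ ∀ (i : Idx L) (ε₁ ε₄ : ℝ), 0 < ε₁ → ε₄ ≤ a₄' → 2 * B₀' * (L : ℝ) ^ 3 * B₃ * ε₁ ≤ ε₄ →
        ∀ (V : GaugeField (i.1.1.P i.1.2.1) 0 (Matrix.specialUnitaryGroup (Fin 2) ℂ)) (U₀ : GaugeField (i.1.1.P i.1.2.2) 0 (Matrix.specialUnitaryGroup (Fin 2) ℂ)),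
          PlaqSmall ε₁ V → RegPr i.1.1 i.1.2.1 i.1.2.2 ((L : ℝ) ^ 3 * B₃ * ε₁) U₀ → CloseAvg i.1.1 i.1.2.1 i.1.2.2 i.2.2.le ((L : ℝ) ^ 3 * ε₁) V U₀ →
          ∃ X : PBond (i.1.1.P i.1.2.2) 0 → Matrix (Fin 2) (Fin 2) ℂ,
            nMax19 i.1.1 i.1.2.1 i.1.2.2 U₀ X < 3 * B₀' * (L : ℝ) ^ 3 * B₃ * ε₁ ∧ (∀ b : PBond (i.1.1.P i.1.2.2) 0, (X b).IsHermitian ∧ Matrix.trace (X b) = 0) ∧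
            AvgCondPrintS i.1.1 i.1.2.1 i.1.2.2 i.2.2.le V U₀ X ∧ IsLandauPrint i.1.1 i.1.2.1 i.1.2.2 U₀ X ∧
            ∀ X' : PBond (i.1.1.P i.1.2.2) 0 → Matrix (Fin 2) (Fin 2) ℂ, nMax19 i.1.1 i.1.2.1 i.1.2.2 U₀ X' < ε₄ → (∀ b : PBond (i.1.1.P i.1.2.2) 0, (X' b).IsHermitian ∧ Matrix.trace (X' b) = 0) →
              AvgCondPrint i.1.1 i.1.2.1 i.1.2.2 i.2.2.le V U₀ X' → IsLandauPrint i.1.1 i.1.2.1 i.1.2.2 U₀ X' →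
                wilsonAction4 (emb15 U₀ (expHermField X)) ≤ wilsonAction4 (emb15 U₀ (expHermField X')) := by
  have hL1 : (1 : ℝ) ≤ (L : ℝ) := by exact_mod_cast hL.le
  have hL0 : (0 : ℝ) < (L : ℝ) := by positivity
  have hL3 : (0 : ℝ) < (L : ℝ) ^ 3 := by positivity
  have hB₃0 : 0 < B₃ := lt_of_lt_of_le (by positivity) hB₃
  have hθ' : 0 < 1 / 2 - θ := by linarith
  -- the constants of C-min
  set B₀' : ℝ := max (max B₀ (5 * M * B₀ / 2)) (1 / 2) with hB₀'_def
  have hB₀le : B₀ ≤ B₀' := (le_max_left _ _).trans (le_max_left _ _)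
  have h5M : 5 * M * B₀ / 2 ≤ B₀' := (le_max_right _ _).trans (le_max_left _ _)
  have hhalf : 1 / 2 ≤ B₀' := le_max_right _ _
  have hB₀'0 : 0 < B₀' := lt_of_lt_of_le (by norm_num) hhalf
  set a₄' : ℝ := min (min (min (min (min (1 / 4) (a₃ / 4)) (1 / (16 * B₀ * C₄))) α) (2 * r / 3)) ((1 / 2 - θ) / (CP * (17088 + cS)))
    with ha₄'_def
  have ha₄'0 : 0 < a₄' :=
    lt_min (lt_min (lt_min (lt_min (lt_min (by norm_num) (by positivity)) (by positivity)) hα) (by positivity)) (by positivity)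
  have ha1 : a₄' ≤ 1 / 4 := (min_le_left _ _).trans ((min_le_left _ _).trans ((min_le_left _ _).trans ((min_le_left _ _).trans (min_le_left _ _))))
  have ha2 : a₄' ≤ a₃ / 4 := (min_le_left _ _).trans ((min_le_left _ _).trans ((min_le_left _ _).trans ((min_le_left _ _).trans (min_le_right _ _))))
  have ha3 : a₄' ≤ 1 / (16 * B₀ * C₄) := (min_le_left _ _).trans ((min_le_left _ _).trans ((min_le_left _ _).trans (min_le_right _ _)))
  have ha4 : a₄' ≤ α := (min_le_left _ _).trans ((min_le_left _ _).trans (min_le_right _ _))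
  have ha5 : a₄' ≤ 2 * r / 3 := (min_le_left _ _).trans (min_le_right _ _)
  have ha6 : a₄' ≤ (1 / 2 - θ) / (CP * (17088 + cS)) := min_le_right _ _
  refine ⟨B₀', a₄', hB₀'0, ha₄'0, ?_⟩
  intro i ε₁ ε₄ hε₁ hε₄a h2B V U₀ hV hreg hclose
  have hFL' : (i.1.1.L : ℝ) = (L : ℝ) := by exact_mod_cast i.2.1
  have hP0 : 0 ≤ (L : ℝ) ^ 3 * B₃ * ε₁ := by positivity
  -- the smallness facts carried by `2B₀′L³B₃ε₁ ≤ ε₄ ≤ a₄′`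
  have hε₄4 : ε₄ ≤ 1 / 4 := hε₄a.trans ha1
  have hlo : (L : ℝ) ^ 3 * B₃ * ε₁ ≤ ε₄ := by
    have h' : (1 : ℝ) * ((L : ℝ) ^ 3 * B₃ * ε₁) ≤ (2 * B₀') * ((L : ℝ) ^ 3 * B₃ * ε₁) := mul_le_mul_of_nonneg_right (by linarith) hP0
    linarith
  have h2B₀ : 2 * B₀ * (L : ℝ) ^ 3 * B₃ * ε₁ ≤ ε₄ := by
    have h' : (2 * B₀) * ((L : ℝ) ^ 3 * B₃ * ε₁) ≤ (2 * B₀') * ((L : ℝ) ^ 3 * B₃ * ε₁) := mul_le_mul_of_nonneg_right (by linarith) hP0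
    linarith
  have hαe : (L : ℝ) ^ 3 * B₃ * ε₁ ≤ α := hlo.trans (hε₄a.trans ha4)
  have h2 : 4 * (2 * B₀ * (L : ℝ) ^ 3 * B₃ * ε₁) ≤ a₃ := by linarith [hε₄a.trans ha2]
  have h3 : 16 * B₀ * C₄ * (2 * B₀ * (L : ℝ) ^ 3 * B₃ * ε₁) ≤ 1 := by
    have hBC : 0 < 16 * B₀ * C₄ := by positivity
    have h' : 2 * B₀ * (L : ℝ) ^ 3 * B₃ * ε₁ ≤ 1 / (16 * B₀ * C₄) := h2B₀.trans (hε₄a.trans ha3)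
    calc 16 * B₀ * C₄ * (2 * B₀ * (L : ℝ) ^ 3 * B₃ * ε₁) ≤ 16 * B₀ * C₄ * (1 / (16 * B₀ * C₄)) := mul_le_mul_of_nonneg_left h' hBC.le
      _ = 1 := by field_simp
  have hdLB₃ : (3 : ℝ) * i.1.1.L ≤ B₃ := by rw [hFL']; exact hB₃
  have hregF : RegPr i.1.1 i.1.2.1 i.1.2.2 ((i.1.1.L : ℝ) ^ 3 * B₃ * ε₁) U₀ := by rw [hFL']; exact hreg
  have hloF : (i.1.1.L : ℝ) ^ 3 * B₃ * ε₁ ≤ ε₄ := by rw [hFL']; exact hlo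
  -- the letters' bounds at this admissible background
  have h𝒢 := norm_G i _ U₀ hreg hαe
  have hW := prop4 i _ U₀ hreg hαe
  have hH₁ := norm_H₁ i _ U₀ hreg hαe
  have hB := bound20 i ε₁ V U₀ hε₁ hV hreg hclose
  -- (103): the datum `H₁B`
  have hH₁B_lt : ‖H₁f i U₀ (Bf i V U₀)‖ < 2 * ((3 : ℝ) * i.1.1.L) * B₀ * (L : ℝ) ^ 3 * ε₁ :=
    calc ‖H₁f i U₀ (Bf i V U₀)‖ ≤ B₀ * ‖Bf i V U₀‖ := hH₁ (Bf i V U₀)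
      _ < B₀ * (2 * ((3 : ℝ) * i.1.1.L) * ((L : ℝ) ^ 3 * ε₁)) := mul_lt_mul_of_pos_left hB hB₀
      _ = 2 * ((3 : ℝ) * i.1.1.L) * B₀ * (L : ℝ) ^ 3 * ε₁ := by ring
  have hH₁B_le : ‖H₁f i U₀ (Bf i V U₀)‖ ≤ 2 * B₀ * (L : ℝ) ^ 3 * B₃ * ε₁ := by
    have h6 : 2 * ((3 : ℝ) * i.1.1.L) * B₀ * (L : ℝ) ^ 3 * ε₁ ≤ 2 * B₀ * (L : ℝ) ^ 3 * B₃ * ε₁ := by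
      have h3L : (3 : ℝ) * i.1.1.L ≤ B₃ := hdLB₃
      have hc : 0 ≤ 2 * B₀ * (L : ℝ) ^ 3 * ε₁ := by positivity
      calc 2 * ((3 : ℝ) * i.1.1.L) * B₀ * (L : ℝ) ^ 3 * ε₁ = ((3 : ℝ) * i.1.1.L) * (2 * B₀ * (L : ℝ) ^ 3 * ε₁) := by ring
        _ ≤ B₃ * (2 * B₀ * (L : ℝ) ^ 3 * ε₁) := mul_le_mul_of_nonneg_right h3L hc
        _ = 2 * B₀ * (L : ℝ) ^ 3 * B₃ * ε₁ := by ring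
    exact hH₁B_lt.le.trans h6
  -- PROPOSITION 6 at the T³ objects (PROVED): the solution `A₁` in the (115)-ball `2B₀L³B₃ε₁`
  obtain ⟨A₁, _hA₁ε, hsol, hA₁3, -⟩ := prop6_T3 (n := i.1.2.1) (e i) (he i) (C₁ := (L : ℝ) ^ 3) (ε₄ := 2 * B₀ * (L : ℝ) ^ 3 * B₃ * ε₁) U₀
    (𝒢 := 𝒢f i U₀) (W := Wf i U₀) h𝒢 hW hB₀ hC₄ hL3 hB₃0 hε₁ hdLB₃ le_rfl h2 h3 hreg (𝔄 := H₁f i U₀ (Bf i V U₀)) hH₁B_lt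
  -- CHART-112 (displayed): the exponent `X`
  have hA₁r : ‖A₁‖ < r := by
    have : 3 * B₀ * (L : ℝ) ^ 3 * B₃ * ε₁ ≤ r := by linarith [hε₄a.trans ha5]
    exact hA₁3.trans_le this
  obtain ⟨X, hXh, hXM, h20, h21, hEL⟩ := hChart i ε₁ V U₀ hε₁ hV hreg hclose hαe A₁ hA₁r hsol
  have hX5 : nMax19 i.1.1 i.1.2.1 i.1.2.2 U₀ X < 5 * M * B₀ * (L : ℝ) ^ 3 * B₃ * ε₁ := by
    have hsum : ‖A₁‖ + ‖H₁f i U₀ (Bf i V U₀)‖ < 5 * B₀ * (L : ℝ) ^ 3 * B₃ * ε₁ := by linarith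
    calc nMax19 i.1.1 i.1.2.1 i.1.2.2 U₀ X ≤ M * (‖A₁‖ + ‖H₁f i U₀ (Bf i V U₀)‖) := hXM
      _ < M * (5 * B₀ * (L : ℝ) ^ 3 * B₃ * ε₁) := mul_lt_mul_of_pos_left hsum hM
      _ = 5 * M * B₀ * (L : ℝ) ^ 3 * B₃ * ε₁ := by ring
  have h52 : 5 * M * B₀ * (L : ℝ) ^ 3 * B₃ * ε₁ ≤ 2 * B₀' * (L : ℝ) ^ 3 * B₃ * ε₁ := by
    have h' : (5 * M * B₀) * ((L : ℝ) ^ 3 * B₃ * ε₁) ≤ (2 * B₀') * ((L : ℝ) ^ 3 * B₃ * ε₁) := mul_le_mul_of_nonneg_right (by linarith) hP0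
    linarith
  have h23 : 2 * B₀' * (L : ℝ) ^ 3 * B₃ * ε₁ ≤ 3 * B₀' * (L : ℝ) ^ 3 * B₃ * ε₁ := by
    have h' : (2 * B₀') * ((L : ℝ) ^ 3 * B₃ * ε₁) ≤ (3 * B₀') * ((L : ℝ) ^ 3 * B₃ * ε₁) := mul_le_mul_of_nonneg_right (by linarith) hP0
    linarith
  have hX2 : nMax19 i.1.1 i.1.2.1 i.1.2.2 U₀ X < 2 * B₀' * (L : ℝ) ^ 3 * B₃ * ε₁ := hX5.trans_le h52
  have hX3 : nMax19 i.1.1 i.1.2.1 i.1.2.2 U₀ X < 3 * B₀' * (L : ℝ) ^ 3 * B₃ * ε₁ := hX2.trans_le h23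
  have hXε : nMax19 i.1.1 i.1.2.1 i.1.2.2 U₀ X < ε₄ := hX2.trans_le h2B
  refine ⟨X, hX3, hXh, h20, h21, ?_⟩
  -- the `NormS`-representative `W = (e^{iX}U₀)^u ∈ 𝔅_k(V)` from the re-based (20)
  have hexp : ∀ b : PBond (i.1.1.P i.1.2.2) 0,
      ((expHermField X b : Matrix.specialUnitaryGroup (Fin 2) ℂ) : Matrix (Fin 2) (Fin 2) ℂ) = NormedSpace.exp (Complex.I • X b) := fun b => by
    rw [expHermField_apply, coe_expHerm (hXh b)]
  obtain ⟨u, hu, hWfib⟩ := h20 (expHermField X) hexp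
  -- GROWTH (★w4's `growth142_T3`, its (γ)-input displayed as `hGrowth`)
  have hκ : 0 ≤ ((1 / 2 - θ) / CP - 96 * (178 * ε₄)) * (((i.1.1.L : ℝ) ^ (i.1.2.2 - i.1.2.1)) ^ 2)⁻¹
      - cS * ε₄ * (((i.1.1.L : ℝ) ^ (i.1.2.2 - i.1.2.1)) ^ 2)⁻¹ := by
    have hη2 : 0 ≤ (((i.1.1.L : ℝ) ^ (i.1.2.2 - i.1.2.1)) ^ 2)⁻¹ := by positivity
    have hsmall : (17088 + cS) * ε₄ ≤ (1 / 2 - θ) / CP := by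
      have h' : ε₄ ≤ (1 / 2 - θ) / (CP * (17088 + cS)) := hε₄a.trans ha6
      rw [le_div_iff₀ (by positivity)] at h'
      rw [le_div_iff₀ hCP]
      linarith
    have key : ∀ η2 : ℝ, 0 ≤ η2 → 0 ≤ ((1 / 2 - θ) / CP - 96 * (178 * ε₄)) * η2 - cS * ε₄ * η2 := by
      intro η2 hη
      have hrw : ((1 / 2 - θ) / CP - 96 * (178 * ε₄)) * η2 - cS * ε₄ * η2 = ((1 / 2 - θ) / CP - (17088 + cS) * ε₄) * η2 := by ring
      rw [hrw]
      exact mul_nonneg (by linarith) hη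
    exact key _ hη2
  exact growth142_T3 i.1.1 i.2.2 hε₄4 hloF V U₀ hregF X hXh hXε u _ rfl hWfib hCP hθ.le hκ
    (hGrowth i ε₁ ε₄ V U₀ X u _ hε₁ hε₄4 hlo hV hreg hclose hXh hXε h20 h21 hu rfl hWfib (hEL u hu hWfib))

end Summit.QuantumFields.YangMills.Theorems.Prop7CminOfP6T3PdS

end
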